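import Literature.NumberTheory.Automorphic.MeyerThetaMellin
import Mathlib.NumberTheory.LSeries.Basic
import HarnessLib

/-!
# Meyer's global difference representation — proofs, `K = ℚ`: unfolding of theta sums with
# coefficients

Topic `NumberTheory/Automorphic`; namespace `Literature.NumberTheory.Automorphic.Meyer`. Sibling
PROOF file (Mathlib + `MeyerThetaMellin`) for the finite-adelic part of the plan for
`Meyer.spectralRealisation_rat` [Meyer2005, Thm. 5.11]: the Mellin transform of the theta sum
`∑_{n ≥ 1} a(n) G(n c t)` of a Schwartz function `G` with BOUNDED coefficients `a(n)` and a dilation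
`c > 0` is `c^{-s} · L(a, s) · MG(s)` for `Re s > 1` (`mellin_tsum_coeff`), `L(a, s) = ∑ a(n) n^{-s}`
being Mathlib's `LSeries a s`. With `a = 1`, `c = 1` this is Riemann's unfolding
(`mellin_tsum_comp_nat_mul`); the coefficients arise from the values on `ℚ` of a `Ẑˣ`-invariant
Schwartz–Bruhat function on the finite adeles (`MeyerRatFiniteInvariants`), whose L-series is a
Dirichlet polynomial times `ζ` (`MeyerGcdDirichlet`) — Meyer's Euler factorisation of the summation
map [Meyer2005, Lemma 5.3, §5.7].

Everything is proved; no definitions, no named facts.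

## References

* R. Meyer, *On a representation of the idele class group related to primes and zeros of
  L-functions*, Duke Math. J. 127 (2005) = arXiv:math/0311468, Lemma 5.3, §5.7 [Meyer2005].
-/

noncomputable section

open MeasureTheory Set Filter Complex
open scoped Topology

namespace Literature.NumberTheory.Automorphic.Meyer

/-- Summability of `n ↦ a(n) G(n c t)` for bounded `a`, Schwartz `G`, `c, t > 0`. [folklore] -/
theorem summable_coeff_schwartz_comp_nat_mul (G : SchwartzMap ℝ ℂ) {a : ℕ → ℂ} {B : ℝ}
    (ha : ∀ n, ‖a n‖ ≤ B) {c t : ℝ} (hc : 0 < c) (ht : 0 < t) :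
    Summable fun n : ℕ => a (n + 1) * G (((n + 1 : ℕ) : ℝ) * (c * t)) := by
  have h := summable_schwartz_comp_nat_mul G (mul_pos hc ht)
  refine Summable.of_norm_bounded (g := fun n : ℕ => B * ‖G (((n + 1 : ℕ) : ℝ) * (c * t))‖) (h.norm.mul_left B)
    fun n => ?_
  rw [norm_mul]
  exact mul_le_mul_of_nonneg_right (ha _) (norm_nonneg _)

/-- **Unfolding with coefficients, `HasSum` form**: for `1 < Re s`,
`mellin (t ↦ ∑_{n≥1} a(n) G(n c t)) s = ∑_{n≥1} a(n) (n c)^{-s} · MG(s)`. [cite: Meyer2005, Lemma 5.3] -/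
theorem hasSum_mellin_coeff (G : SchwartzMap ℝ ℂ) {a : ℕ → ℂ} {B : ℝ} (ha : ∀ n, ‖a n‖ ≤ B)
    {c : ℝ} (hc : 0 < c) {s : ℂ} (hs : 1 < s.re) :
    HasSum (fun n : ℕ => a (n + 1) * ((((n + 1 : ℕ) : ℝ) * c : ℝ) : ℂ) ^ (-s) * mellin (fun t : ℝ => G t) s)
      (mellin (fun t : ℝ => ∑' n : ℕ, a (n + 1) * G (((n + 1 : ℕ) : ℝ) * (c * t))) s) := by
  have hB : 0 ≤ B := le_trans (norm_nonneg _) (ha 0)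
  set F : ℕ → ℝ → ℂ := fun n t => (t : ℂ) ^ (s - 1) • (a (n + 1) * G ((((n + 1 : ℕ) : ℝ) * c) * t)) with hF
  have hpos : ∀ n : ℕ, (0 : ℝ) < ((n + 1 : ℕ) : ℝ) * c := fun n => by positivity
  -- integrability of the terms
  have hint : ∀ n : ℕ, Integrable (F n) (volume.restrict (Ioi (0 : ℝ))) := by
    intro n
    have h := ((MellinConvergent.comp_mul_left (f := fun t : ℝ => G t) (s := s) (hpos n)).mpr
      (mellinConvergent_schwartz G (by linarith))).const_mul (a (n + 1))
    refine (h.congr (Eventually.of_forall fun t => ?_))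
    simp only [hF, smul_eq_mul]
    ring
  -- summability of the integrals of the norms
  set I : ℝ := ∫ t in Ioi (0 : ℝ), t ^ (s.re - 1) * ‖G t‖ with hI
  have hI0 : 0 ≤ I := setIntegral_nonneg measurableSet_Ioi fun t ht => by
    have : 0 ≤ t ^ (s.re - 1) := Real.rpow_nonneg (le_of_lt ht) _
    positivity
  have hnorm : ∀ n : ℕ, ∫ t in Ioi (0 : ℝ), ‖F n t‖ = ‖a (n + 1)‖ * (((((n + 1 : ℕ) : ℝ) * c) ^ s.re)⁻¹ * I) := by
    intro n
    have h := integral_norm_mellin_integrand_comp_mul (fun t : ℝ => G t) s (hpos n)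
    rw [Real.rpow_neg (hpos n).le] at h
    rw [← h, ← integral_const_mul]
    refine setIntegral_congr_fun measurableSet_Ioi fun t _ => ?_
    simp only [hF, smul_eq_mul, norm_mul]
    ring
  have hsum : Summable fun n : ℕ => ∫ t in Ioi (0 : ℝ), ‖F n t‖ := by
    have h1 : Summable fun n : ℕ => (((n : ℝ) ^ s.re)⁻¹ : ℝ) := Real.summable_nat_rpow_inv.mpr hs
    have h2 : Summable fun n : ℕ => ((((n + 1 : ℕ) : ℝ) ^ s.re)⁻¹ : ℝ) := (summable_nat_add_iff 1).mpr h1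
    have h3 : Summable fun n : ℕ => B * ((c ^ s.re)⁻¹ * ((((n + 1 : ℕ) : ℝ) ^ s.re)⁻¹ * I)) :=
      ((h2.mul_right I).mul_left _).mul_left B
    refine Summable.of_nonneg_of_le (fun n => ?_) (fun n => ?_) h3
    · exact integral_nonneg fun t => norm_nonneg _
    · rw [hnorm n, Real.mul_rpow (by positivity) hc.le, mul_inv]
      have : ((((n + 1 : ℕ) : ℝ) ^ s.re)⁻¹ * (c ^ s.re)⁻¹ * I) = (c ^ s.re)⁻¹ * ((((n + 1 : ℕ) : ℝ) ^ s.re)⁻¹ * I) := by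
        ring
      rw [this]
      exact mul_le_mul_of_nonneg_right (ha _) (by positivity)
  have H := hasSum_integral_of_summable_integral_norm hint hsum
  -- identify both sides
  have hterm : ∀ n : ℕ, ∫ t in Ioi (0 : ℝ), F n t =
      a (n + 1) * ((((n + 1 : ℕ) : ℝ) * c : ℝ) : ℂ) ^ (-s) * mellin (fun t : ℝ => G t) s := by
    intro n
    have h := mellin_comp_mul_left (fun t : ℝ => G t) s (hpos n)
    rw [mellin] at h
    rw [mul_assoc, ← smul_eq_mul (a := (((((n + 1 : ℕ) : ℝ) * c : ℝ) : ℂ) ^ (-s))), ← h, ← integral_const_mul]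
    refine setIntegral_congr_fun measurableSet_Ioi fun t _ => ?_
    simp only [hF, smul_eq_mul]
    ring
  have htot : (∫ t in Ioi (0 : ℝ), ∑' n : ℕ, F n t) =
      mellin (fun t : ℝ => ∑' n : ℕ, a (n + 1) * G (((n + 1 : ℕ) : ℝ) * (c * t))) s := by
    rw [mellin]
    refine setIntegral_congr_fun measurableSet_Ioi fun t _ => ?_
    simp only [hF, smul_eq_mul]
    rw [← tsum_mul_left]
    refine tsum_congr fun n => ?_
    ring_nf
  simp_rw [hterm] at H
  rw [htot] at H
  exact H

/-- The L-series as a sum over `n ≥ 1` written with the shift `n ↦ n + 1`. [folklore] -/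
theorem LSeries_eq_tsum_succ {a : ℕ → ℂ} {s : ℂ} (h : LSeriesSummable a s) :
    LSeries a s = ∑' n : ℕ, a (n + 1) * (((n + 1 : ℕ) : ℝ) : ℂ) ^ (-s) := by
  rw [LSeries, tsum_eq_zero_add' ((summable_nat_add_iff 1).mpr h), LSeries.term_zero, zero_add]
  refine tsum_congr fun n => ?_
  rw [LSeries.term_of_ne_zero (Nat.succ_ne_zero n), cpow_neg, div_eq_mul_inv]
  push_cast
  rfl

/-- **Unfolding with coefficients**: for bounded `a`, `c > 0` and `1 < Re s`,
`∫₀^∞ (∑_{n≥1} a(n) G(nct)) t^{s-1} dt = c^{-s} · L(a, s) · MG(s)`. [cite: Meyer2005, Lemma 5.3] -/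
theorem mellin_tsum_coeff (G : SchwartzMap ℝ ℂ) {a : ℕ → ℂ} {B : ℝ} (ha : ∀ n, ‖a n‖ ≤ B)
    {c : ℝ} (hc : 0 < c) {s : ℂ} (hs : 1 < s.re) :
    mellin (fun t : ℝ => ∑' n : ℕ, a (n + 1) * G (((n + 1 : ℕ) : ℝ) * (c * t))) s =
      (c : ℂ) ^ (-s) * LSeries a s * mellin (fun t : ℝ => G t) s := by
  have hsum : LSeriesSummable a s := LSeriesSummable_of_bounded_of_one_lt_re (m := B) (fun n _ => ha n) hs
  rw [← (hasSum_mellin_coeff G ha hc hs).tsum_eq, LSeries_eq_tsum_succ hsum]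
  have h1 : (c : ℂ) ^ (-s) * (∑' n : ℕ, a (n + 1) * (((n + 1 : ℕ) : ℝ) : ℂ) ^ (-s)) * mellin (fun t : ℝ => G t) s =
      ∑' n : ℕ, (c : ℂ) ^ (-s) * (a (n + 1) * (((n + 1 : ℕ) : ℝ) : ℂ) ^ (-s)) * mellin (fun t : ℝ => G t) s := by
    rw [← tsum_mul_left, ← tsum_mul_right]
  rw [h1]
  refine tsum_congr fun n => ?_
  rw [Complex.ofReal_mul, Complex.mul_cpow_ofReal_nonneg (by positivity) hc.le]
  push_cast
  ring

end Literature.NumberTheory.Automorphic.Meyer
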